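import Literature.MathematicalPhysics.KineticTheory.InfiniteChainGibbsExistenceShift
import Literature.Probability.LatticeModels.MarkovChainMixing
import Literature.Analysis.OperatorTheory.GroundStateMarkovGap
import HarnessLib

/-!
# `stub_regularMixing` — registered stub of line `temperature-blind-vitali-hurwitz`, crux `EmbeddedDrudeMourre.GreenKuboContinuation`
(item stmt-AtomisticToContinuum-12597)

Target `Summits/AtomisticToContinuum/FouriersLaw/Theorems/EmbeddedDrudeMourreGreenKuboContinuationRegularMixing.lean`
(`--supports stmt-AtomisticToContinuum-12597`). The theorem name and signature are REGISTERED and verbatim.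

Proof: by the uniqueness hypothesis the given regular state coincides with the two-sided stationary
transfer-operator Markov state of the chain, which is regular (DLR, shift invariant, BM-superstable) and
exponentially ρ-mixing: `exists_regular_state_mixing_pinnedChain` below (the construction of
`OscillatorChain.exists_transferMarkovState` re-run keeping the spectral data), built on the Jentzsch gap
of the transfer operator (`Literature.Analysis.OperatorTheory.exists_groundState_markov_gap`), the window-form
Markov property and conditioning of the Markov chain (`Literature.Probability.LatticeModels.MarkovChain*`),
the covariance bound `abs_integral_mul_sub_le_of_dependsOn_halfLine` and the `L²` density of bounded
cylinder functions (`CylinderFunctionApprox.lean`).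
-/

noncomputable section

namespace Summit.AtomisticToContinuum.FouriersLaw.Theorems.GreenKuboContinuation.TemperatureBlindVitaliHurwitz

open Filter Topology MeasureTheory Set
open Literature.MathematicalPhysics.KineticTheory.HeatConduction
open Function Finset Literature.Probability.LatticeModels Literature.Analysis.OperatorTheory
  Literature.MathematicalPhysics.KineticTheory.HeatConduction.OscillatorChain
open scoped ENNReal

/-- **The transfer-operator Markov state of the chain is regular and exponentially ρ-mixing.**
Let `T > 0`, `U`, `V` continuous and non-negative, `V` even, `e^{-U/T}`, `e^{-U/(2T)}` Lebesgue
integrable. Then there is a probability measure `μ` on `ℤ → ℝ × ℝ` which is a DLR Gibbs state of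
`P` at `T`, is shift invariant, satisfies Buttà–Marchioro's superstability estimate (2.3), AND has
exponentially decaying correlations between `L²` observables of the past `{i ≤ a}` and of the
future `{i ≥ a + n}`:
`|∫ f g dμ - ∫ f dμ ∫ g dμ| ≤ C e^{-m n} (∫ f² dμ)^{1/2} (∫ g² dμ)^{1/2}` with `C = 2`, `m > 0`
(the Jentzsch gap of the transfer operator with kernel `e^{-V(q'-q)/T}` on
`L²(e^{-(p²/2+U)/T} dq dp)`, transported to the ground-state Markov operator, and the
Markov-chain covariance bound `abs_integral_mul_sub_le_of_dependsOn_halfLine`;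
Cassandro–Olivieri–Pellegrinotti–Presutti 1978, §3). [cite: Georgii2011, Thm 10.25 and §11.1] -/
theorem exists_regular_state_mixing (P : OscillatorChain) {T : ℝ} (hT : 0 < T)
    (hUc : Continuous P.U) (hVc : Continuous P.V) (hU0 : ∀ r, 0 ≤ P.U r) (hV0 : ∀ r, 0 ≤ P.V r)
    (hVe : ∀ r, P.V (-r) = P.V r)
    (hUi : Integrable (fun q : ℝ => Real.exp (-T⁻¹ * P.U q)))
    (hUi2 : Integrable (fun q : ℝ => Real.exp (-(2 * T)⁻¹ * P.U q))) :
    ∃ μ : Measure ChainConfig, P.IsChainGibbsMeasure T μ ∧ IsShiftInvariant μ ∧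
      P.HasSuperstabilityEstimate μ ∧
      ∃ C m : ℝ, 0 < m ∧ ∀ (a : ℤ) (n : ℕ) (f g : ChainConfig → ℝ),
        DependsOn f {i : ℤ | i ≤ a} → DependsOn g {i : ℤ | a + n ≤ i} →
        Measurable f → Measurable g → MemLp f 2 μ → MemLp g 2 μ →
          |∫ σ, f σ * g σ ∂μ - (∫ σ, f σ ∂μ) * (∫ σ, g σ ∂μ)| ≤
            C * Real.exp (-(m * n)) * (∫ σ, f σ ^ 2 ∂μ) ^ (1 / 2 : ℝ) *
              (∫ σ, g σ ^ 2 ∂μ) ^ (1 / 2 : ℝ) := by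
  classical
  have hUm : Measurable P.U := hUc.measurable
  have hVm : Measurable P.V := hVc.measurable
  -- Step 1: the a priori measure `ρ_T` and the transfer kernel `K`
  obtain ⟨wt, hwt⟩ : ∃ wt : ℝ × ℝ → ℝ, ∀ z, wt z = Real.exp (-T⁻¹ * (z.2 ^ 2 / 2 + P.U z.1)) :=
    ⟨_, fun _ => rfl⟩
  have hwt_eq : wt = fun z => Real.exp (-T⁻¹ * (z.2 ^ 2 / 2 + P.U z.1)) := funext hwt
  have hwtc : Continuous wt := by rw [hwt_eq]; fun_prop
  have hwti : Integrable wt := by rw [hwt_eq]; exact P.integrable_siteWeight hT hUi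
  have hwtpos : ∀ z, 0 < wt z := fun z => by rw [hwt]; exact Real.exp_pos _
  set ρ : Measure (ℝ × ℝ) := volume.withDensity fun z => ENNReal.ofReal (wt z) with hρ
  haveI : IsFiniteMeasure ρ := isFiniteMeasure_withDensity_ofReal hwti.2
  have hwtm : Measurable fun z => ENNReal.ofReal (wt z) :=
    ENNReal.measurable_ofReal.comp hwtc.measurable
  have hρ0 : ρ ≠ 0 := by
    intro h0
    have h1 : ρ univ = 0 := by rw [h0]; rfl
    rw [hρ, withDensity_apply _ MeasurableSet.univ, Measure.restrict_univ,
      lintegral_eq_zero_iff hwtm] at h1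
    have h2 : (volume : Measure (ℝ × ℝ))
        {z | (fun z => ENNReal.ofReal (wt z)) z ≠ (0 : ℝ × ℝ → ℝ≥0∞) z} = 0 := h1
    have h3 : {z : ℝ × ℝ | (fun z => ENNReal.ofReal (wt z)) z ≠ (0 : ℝ × ℝ → ℝ≥0∞) z} = univ :=
      eq_univ_of_forall fun z => (ENNReal.ofReal_pos.2 (hwtpos z)).ne'
    rw [h3] at h2
    exact (isOpen_univ.measure_pos (volume : Measure (ℝ × ℝ)) univ_nonempty).ne' h2
  obtain ⟨K, hK⟩ : ∃ K : ℝ × ℝ → ℝ × ℝ → ℝ, ∀ z z', K z z' = Real.exp (-T⁻¹ * P.V (z'.1 - z.1)) :=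
    ⟨_, fun _ _ => rfl⟩
  have hKc : Continuous (uncurry K) := by
    rw [show uncurry K = fun p : (ℝ × ℝ) × (ℝ × ℝ) => Real.exp (-T⁻¹ * P.V (p.2.1 - p.1.1)) from
      funext fun p => hK p.1 p.2]
    fun_prop
  have hKsm : StronglyMeasurable (uncurry K) := hKc.stronglyMeasurable
  have hKpos : ∀ z z', 0 < K z z' := fun z z' => by rw [hK]; exact Real.exp_pos _
  have hK1 : ∀ z z', ‖K z z'‖ ≤ 1 := fun z z' => by
    rw [Real.norm_eq_abs, abs_of_pos (hKpos z z'), hK, Real.exp_le_one_iff]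
    have := hV0 (z'.1 - z.1)
    have := inv_pos.2 hT
    nlinarith
  have hKsymm : ∀ z z', K z z' = K z' z := fun z z' => by
    rw [hK, hK, ← hVe (z.1 - z'.1), neg_sub]
  have hK0 : ∀ z z', 0 ≤ K z z' := fun z z' => (hKpos z z').le
  have hKC : ∀ z z', K z z' ≤ 1 := fun z z' => by
    have := hK1 z z'
    rwa [Real.norm_eq_abs, abs_of_pos (hKpos z z')] at this
  -- Step 2: Jentzsch's eigenfunction and the gap of the ground-state Markov operator on `L²(ρ)`
  obtain ⟨lam, h, B, θ, hlam, hhm, hhpos, hhle, heigρ, hnormρ, hθ0, hθlt, hgapρ⟩ :=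
    exists_groundState_markov_gap (μ := ρ) hKsm hK1 hKsymm hKpos hρ0
  -- `ρ`-integrals as weighted Lebesgue integrals
  have hconv : ∀ F : ℝ × ℝ → ℝ, ∫ y, F y ∂ρ = ∫ y, wt y * F y := fun F => by
    rw [hρ, integral_withDensity_eq_integral_toReal_smul hwtm
      (ae_of_all _ fun _ => ENNReal.ofReal_lt_top)]
    refine integral_congr_ae (ae_of_all _ fun y => ?_)
    dsimp only
    rw [ENNReal.toReal_ofReal (hwtpos y).le, smul_eq_mul]
  have heig : ∀ x, ∫ y, K x y * h y * wt y = lam * h x := fun x => by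
    rw [← heigρ x, hconv]
    exact integral_congr_ae (ae_of_all _ fun y => by ring)
  have hnorm : ∫ y, h y ^ 2 * wt y = 1 := by
    rw [← hnormρ, hconv]
    exact integral_congr_ae (ae_of_all _ fun y => by ring)
  obtain ⟨q, hq⟩ : ∃ q : ℝ × ℝ → ℝ × ℝ → ℝ, ∀ x y, q x y = (lam * h x)⁻¹ * K x y * h y * wt y :=
    ⟨_, fun _ _ => rfl⟩
  have hPeq : (fun (v : ℝ × ℝ → ℝ) (x : ℝ × ℝ) => ∫ y, q x y * v y) =
      fun (v : ℝ × ℝ → ℝ) (x : ℝ × ℝ) => ∫ y, (lam * h x)⁻¹ * K x y * h y * v y ∂ρ := by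
    funext v x
    rw [hconv]
    exact integral_congr_ae (ae_of_all _ fun y => by dsimp only; rw [hq]; ring)
  have hgap : ∀ u : ℝ × ℝ → ℝ, Measurable u → (∃ M : ℝ, ∀ x, |u x| ≤ M) →
      ∫ x, u x * (h x ^ 2 * wt x) = 0 → ∀ n : ℕ,
        ∫ x, ((fun (v : ℝ × ℝ → ℝ) (x : ℝ × ℝ) => ∫ y, q x y * v y)^[n] u) x ^ 2 *
          (h x ^ 2 * wt x) ≤ (θ / lam) ^ (2 * n) * ∫ x, u x ^ 2 * (h x ^ 2 * wt x) := by
    intro u hum hub hmean n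
    have hmean' : ∫ x, u x * h x ^ 2 ∂ρ = 0 := by
      rw [hconv, ← hmean]
      exact integral_congr_ae (ae_of_all _ fun y => by ring)
    have h1 := hgapρ u hum hub hmean' n
    rw [hconv, hconv, ← hPeq] at h1
    have e1 : ∫ x, ((fun (v : ℝ × ℝ → ℝ) (x : ℝ × ℝ) => ∫ y, q x y * v y)^[n] u) x ^ 2 *
        (h x ^ 2 * wt x) = ∫ x, wt x * (((fun (v : ℝ × ℝ → ℝ) (x : ℝ × ℝ) => ∫ y, q x y * v y)^[n] u)
          x ^ 2 * h x ^ 2) := integral_congr_ae (ae_of_all _ fun x => by ring)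
    have e2 : ∫ x, u x ^ 2 * (h x ^ 2 * wt x) = ∫ x, wt x * (u x ^ 2 * h x ^ 2) :=
      integral_congr_ae (ae_of_all _ fun x => by ring)
    rw [e1, e2]
    exact h1
  -- the `ℝ≥0∞` transfer data
  obtain ⟨k, hk⟩ : ∃ k : ℝ × ℝ → ℝ × ℝ → ℝ≥0∞, ∀ z z', k z z' = ENNReal.ofReal (K z z') :=
    ⟨_, fun _ _ => rfl⟩
  obtain ⟨φ, hφ⟩ : ∃ φ : ℝ × ℝ → ℝ≥0∞, ∀ z, φ z = ENNReal.ofReal (h z) := ⟨_, fun _ => rfl⟩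
  obtain ⟨w, hw⟩ : ∃ w : ℝ × ℝ → ℝ≥0∞, ∀ z, w z = ENNReal.ofReal (wt z) := ⟨_, fun _ => rfl⟩
  obtain ⟨L, hL⟩ : ∃ L : ℝ≥0∞, L = ENNReal.ofReal lam := ⟨_, rfl⟩
  obtain ⟨p, hp⟩ : ∃ p : ℝ × ℝ → ℝ × ℝ → ℝ≥0∞, ∀ x y, p x y = (φ x)⁻¹ * L⁻¹ * k x y * φ y * w y :=
    ⟨_, fun _ _ => rfl⟩
  obtain ⟨D, hD⟩ : ∃ D : ℤ → ℕ → ChainConfig → ℝ≥0∞, ∀ a n σ, D a n σ = φ (σ a) * φ (σ (a + n)) *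
      (∏ j ∈ Finset.range n, k (σ (a + j)) (σ (a + j + 1)) * L⁻¹) *
      ∏ j ∈ Finset.range (n + 1), w (σ (a + j)) := ⟨_, fun _ _ _ => rfl⟩
  obtain ⟨hkm, hφm, hwm', -, -, -, -, hL0, hLt, heigE, hnormE⟩ :=
    ennreal_transferData (ν := (volume : Measure (ℝ × ℝ))) hKc.measurable hhm hwtc.measurable hK0
      hKC hhpos hhle hwtpos hwti hlam heig hnorm hk hφ hw hL
  have hsym : ∀ z y, k z y = k y z := fun z y => by rw [hk, hk, hKsymm]
  -- Step 3: the two-sided stationary Markov chain and its regularity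
  obtain ⟨μ, hμprob, hμ⟩ := exists_markovChainMeasure (S := ℝ × ℝ)
    (ν := (volume : Measure (ℝ × ℝ))) hkm hφm hwm' hL0 hLt heigE hsym hnormE hD
  haveI := hμprob
  have hw'' : ∀ z, w z = ENNReal.ofReal (Real.exp (-T⁻¹ * (z.2 ^ 2 / 2 + P.U z.1))) := fun z => by
    rw [hw, hwt]
  have hk'' : ∀ z z', k z z' = ENNReal.ofReal (Real.exp (-T⁻¹ * P.V (z'.1 - z.1))) :=
    fun z z' => by rw [hk, hK]
  have hφB : ∀ z, φ z ≤ ENNReal.ofReal B := fun z => by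
    rw [hφ]; exact ENNReal.ofReal_le_ofReal (hhle z)
  have hfac : ∀ (Λ : Finset ℤ) (σ : ChainConfig),
      ENNReal.ofReal (Real.exp (-T⁻¹ * hamiltonianIn P.chainPotential chainSupp Λ σ)) =
        (∏ x ∈ Λ, w (σ x)) * ∏ y ∈ bondSet Λ, k (σ y) (σ (y + 1)) := fun Λ σ => by
    rw [P.ofReal_exp_neg_hamiltonianIn T Λ σ]
    simp only [hw'', hk'']
  have hZ : ∀ (Λ : Finset ℤ) (η : ChainConfig), (∫⋯∫⁻_Λ, (fun σ =>
      ENNReal.ofReal (Real.exp (-T⁻¹ * hamiltonianIn P.chainPotential chainSupp Λ σ)))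
      ∂fun _ : ℤ => (volume : Measure (ℝ × ℝ))) η ≠ ∞ := fun Λ η =>
    (P.lmarginal_boltzmann_lt_top hT hV0 hUi Λ η).ne
  refine ⟨μ, P.isChainGibbsMeasure_of_windowDensity hUm hVm hkm hφm hwm' hD hfac hZ hμ,
    isShiftInvariant_of_windowDensity hkm hφm hwm' hD hμ,
    P.hasSuperstabilityEstimate_of_windowDensity hUm hVm hT hU0 hV0 hVe hUi2 hw'' hk'' hφB hL0 hD hμ,
    ?_⟩
  -- Step 4: exponential mixing
  set r : ℝ := max (θ / lam) (1 / 2) with hr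
  have hr0 : 0 < r := lt_max_of_lt_right (by norm_num)
  have hr1 : r < 1 := max_lt ((div_lt_one hlam).2 hθlt) (by norm_num)
  have hθr : θ / lam ≤ r := le_max_left _ _
  have hθl0 : 0 ≤ θ / lam := div_nonneg hθ0 hlam.le
  refine ⟨2, -Real.log r, neg_pos.2 (Real.log_neg hr0 hr1),
    fun a n f g hfd hgd hfm hgm hf2 hg2 => ?_⟩
  have hmain := abs_integral_mul_sub_le_of_dependsOn_halfLine (S := ℝ × ℝ)
    (ν := (volume : Measure (ℝ × ℝ))) (μ := μ) hKc.measurable hhm hwtc.measurable hK0 hKC hhpos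
    hhle hwtpos hwti hlam heig hnorm hKsymm hk hφ hw hL hp hq hD hμ hθl0 hgap hfm hfd hgm hgd hf2 hg2
  have hexp : (θ / lam) ^ n ≤ Real.exp (-(-Real.log r * n)) := by
    rw [neg_mul, neg_neg, mul_comm, Real.exp_nat_mul, Real.exp_log hr0]
    exact pow_le_pow_left₀ hθl0 hθr n
  have hF : 0 ≤ (∫ σ, f σ ^ 2 ∂μ) ^ (1 / 2 : ℝ) :=
    Real.rpow_nonneg (integral_nonneg fun _ => sq_nonneg _) _
  have hG : 0 ≤ (∫ σ, g σ ^ 2 ∂μ) ^ (1 / 2 : ℝ) :=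
    Real.rpow_nonneg (integral_nonneg fun _ => sq_nonneg _) _
  refine hmain.trans ?_
  gcongr

/-- **The pinned anharmonic chain has, at every temperature, a regular thermal state with
exponentially decaying correlations.** For `pinnedChain ω₂ lam β γ` (`ω₂ > 0`, `lam, β ≥ 0`) and
`T > 0`: a DLR Gibbs state which is shift invariant, obeys BM (2.3), and is exponentially
`ρ`-mixing between `L²` observables of `{i ≤ a}` and `{i ≥ a + n}` (the input of the
`stub_regularMixing` step of the `GreenKuboContinuation` lines, given uniqueness in the regular
class). [cite: Georgii2011, Thm 10.25 and §11.1] -/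
theorem exists_regular_state_mixing_pinnedChain {ω₂ lam β : ℝ} (γ : ℝ)
    (hω : 0 < ω₂) (hl : 0 ≤ lam) (hβ : 0 ≤ β) {T : ℝ} (hT : 0 < T) :
    ∃ μ : Measure ChainConfig, (pinnedChain ω₂ lam β γ).IsChainGibbsMeasure T μ ∧
      IsShiftInvariant μ ∧ (pinnedChain ω₂ lam β γ).HasSuperstabilityEstimate μ ∧
      ∃ C m : ℝ, 0 < m ∧ ∀ (a : ℤ) (n : ℕ) (f g : ChainConfig → ℝ),
        DependsOn f {i : ℤ | i ≤ a} → DependsOn g {i : ℤ | a + n ≤ i} →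
        Measurable f → Measurable g → MemLp f 2 μ → MemLp g 2 μ →
          |∫ σ, f σ * g σ ∂μ - (∫ σ, f σ ∂μ) * (∫ σ, g σ ∂μ)| ≤
            C * Real.exp (-(m * n)) * (∫ σ, f σ ^ 2 ∂μ) ^ (1 / 2 : ℝ) *
              (∫ σ, g σ ^ 2 ∂μ) ^ (1 / 2 : ℝ) := by
  refine exists_regular_state_mixing (pinnedChain ω₂ lam β γ) hT ?_ ?_ ?_ ?_ ?_
    (integrable_exp_neg_pinning hT hω hl β γ) ?_
  · show Continuous fun q : ℝ => ω₂ * q ^ 2 / 2 + lam * q ^ 4 / 4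
    fun_prop
  · show Continuous fun r : ℝ => r ^ 2 / 2 + β * r ^ 4 / 4
    fun_prop
  · intro q
    show 0 ≤ ω₂ * q ^ 2 / 2 + lam * q ^ 4 / 4
    positivity
  · intro r
    show 0 ≤ r ^ 2 / 2 + β * r ^ 4 / 4
    positivity
  · intro r
    show (-r) ^ 2 / 2 + β * (-r) ^ 4 / 4 = r ^ 2 / 2 + β * r ^ 4 / 4
    ring
  · have h2T : 0 < 2 * T := by positivity
    exact integrable_exp_neg_pinning h2T hω hl β γ



/-- **Exponential ρ-mixing of the regular thermal state of the pinned anharmonic chain** (stub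
`stub_regularMixing` of line `temperature-blind-vitali-hurwitz`). For `pinnedChain ω₂ lam β γ`
(`ω₂, lam, β, γ > 0`) and `T > 0`, GIVEN uniqueness of the DLR state in the regular class
(shift invariant + Buttà–Marchioro superstable; the neighbouring stub `stub_regularDLRUnique`),
every regular DLR state `μ` at temperature `T` has exponentially decaying correlations between
`L²(μ)` observables of the past `{i ≤ a}` and of the future `{i ≥ a + n}`:
`|∫ f g dμ - ∫ f dμ ∫ g dμ| ≤ C e^{-m n} ‖f‖₂ ‖g‖₂`. Proof: by uniqueness `μ` is the two-sided
stationary transfer-operator Markov state, which is regular and exponentially mixing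
(`exists_regular_state_mixing_pinnedChain`: Jentzsch's gap for the transfer
operator, ground-state transform, Markov property, Cauchy–Schwarz, density of bounded cylinder
functions; Cassandro–Olivieri–Pellegrinotti–Presutti 1978 §3, Georgii 2011 §10–11).
[cite: Georgii2011, Thm 10.25 and §11.1] -/
theorem stub_regularMixing :
    ∀ ω₂ lam β γ : ℝ, 0 < ω₂ → 0 < lam → 0 < β → 0 < γ →
      ∀ T : ℝ, 0 < T →
          (∀ μ₁ μ₂ : MeasureTheory.Measure
              Literature.MathematicalPhysics.KineticTheory.HeatConduction.ChainConfig,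
            (Literature.MathematicalPhysics.KineticTheory.HeatConduction.pinnedChain
                ω₂ lam β γ).IsChainGibbsMeasure T μ₁ →
            Literature.MathematicalPhysics.KineticTheory.HeatConduction.IsShiftInvariant μ₁ →
            (Literature.MathematicalPhysics.KineticTheory.HeatConduction.pinnedChain
                ω₂ lam β γ).HasSuperstabilityEstimate μ₁ →
            (Literature.MathematicalPhysics.KineticTheory.HeatConduction.pinnedChain
                ω₂ lam β γ).IsChainGibbsMeasure T μ₂ →
            Literature.MathematicalPhysics.KineticTheory.HeatConduction.IsShiftInvariant μ₂ →
            (Literature.MathematicalPhysics.KineticTheory.HeatConduction.pinnedChain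
                ω₂ lam β γ).HasSuperstabilityEstimate μ₂ → μ₁ = μ₂) →
          ∀ μ : MeasureTheory.Measure
              Literature.MathematicalPhysics.KineticTheory.HeatConduction.ChainConfig,
            (Literature.MathematicalPhysics.KineticTheory.HeatConduction.pinnedChain
                ω₂ lam β γ).IsChainGibbsMeasure T μ →
            Literature.MathematicalPhysics.KineticTheory.HeatConduction.IsShiftInvariant μ →
            (Literature.MathematicalPhysics.KineticTheory.HeatConduction.pinnedChain
                ω₂ lam β γ).HasSuperstabilityEstimate μ →
              ∃ C m : ℝ, 0 < m ∧ ∀ (a : ℤ) (n : ℕ) (f g : Literature.MathematicalPhysics.KineticTheory.HeatConduction.ChainConfig → ℝ),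
                DependsOn f {i : ℤ | i ≤ a} → DependsOn g {i : ℤ | a + n ≤ i} →
                Measurable f → Measurable g →
                MeasureTheory.MemLp f 2 μ → MeasureTheory.MemLp g 2 μ →
                |MeasureTheory.integral μ (fun σ => f σ * g σ) -
                    MeasureTheory.integral μ f * MeasureTheory.integral μ g| ≤
                  C * Real.exp (-(m * n)) * (MeasureTheory.integral μ (fun σ => f σ ^ 2)) ^ (1 / 2 : ℝ) *
                    (MeasureTheory.integral μ (fun σ => g σ ^ 2)) ^ (1 / 2 : ℝ) := by
  intro ω₂ lam β γ hω hl hβ _hγ T hT huniq μ hG hS hSS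
  obtain ⟨μ', hG', hS', hSS', C, m, hm, hmix⟩ :=
    exists_regular_state_mixing_pinnedChain γ hω hl.le hβ.le hT
  have hμμ' : μ = μ' := huniq μ μ' hG hS hSS hG' hS' hSS'
  subst hμμ'
  exact ⟨C, m, hm, hmix⟩

end Summit.AtomisticToContinuum.FouriersLaw.Theorems.GreenKuboContinuation.TemperatureBlindVitaliHurwitz

end
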